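import Summits.CriticalPhenomena.CardyFormulaZ2.Theorems.CardyIKTransportIKLinearTransportWallDominationDefs

/-!
# `CardyIKTransport.IKLinearTransport` (stmt-CriticalPhenomena-5076), line `pinned-diagram-exchange`, lead c8 wave 1 —
# WALL DOMINATION, one wall: `stub_lastFaceMonoGen`, `stub_oneWallDomination_of` and the Fubini `cylProb_snoc`

Support file (`--supports stmt-CriticalPhenomena-5076`).  Three registered names of the wall-domination skeleton
(`…WallDominationDefs`), no new definitions:
* `cylProb_snoc` — FUBINI OVER THE LAST COLUMN for an arbitrary event `E` of the wider slab: the sister line's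
  `LastFaceMonoStub.cylArcs_snoc` with the arcs event freed (its ingredients `LastFaceMonoStub.num_snoc` and
  `LastFaceMonoStub.cylZ_snoc` are already general in the event);
* `stub_lastFaceMonoGen : LastColMonoGen → LastFaceMonoGen` — the pointwise last-column inequality for
  wall-monotone events integrates against the nonnegative weights `cylWeight w L τ` (verbatim
  `stub_lastFaceMono_of`);
* `stub_oneWallDomination_of : PermInvariance → WallMonotoneOffCol → LastFaceMonoGen → OneWallDomination` —
  induction on the number of isotropic face columns.  THE STEP (`OneWallStub.cylProb_update_le`): switching ONE
  isotropic face column `j₀` to honeycomb does not increase the probability of a wall-monotone event.  With the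
  transposition `π := Equiv.swap j₀ (Fin.last m)` of the face columns and `θ j := τ (π j.castSucc)`,
  `Function.update τ j₀ false ∘ π = Fin.snoc θ false` and `τ ∘ π = Fin.snoc θ (τ j₀)` on the nose
  (`OneWallStub.update_comp_swap`, `OneWallStub.comp_swap`), so `LastFaceMonoGen` on the last face column, moved
  into place by `PermInvariance` (fed with `WallMonotoneOffCol`), is the step; no sorting is needed.
-/

noncomputable section

namespace Summit.CriticalPhenomena.CardyFormulaZ2.Theorems.IKLinearTransport.PinnedDiagramExchange.WallDomination

open scoped BigOperators Classical
open Finset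
open Summit.CriticalPhenomena.CardyFormulaZ2.Cruxes.IKMixedBoxCrossing.DefectClosureExploration
open CylBunchStub (resLE resLast splitEquiv colConst)

/-- **FUBINI OVER THE LAST COLUMN** (registered helper): the probability of an event `E` of the slab of `w + 1`
face columns with face types `Fin.snoc τ b` is the average, under the law of the slab of `w` face columns with face
types `τ`, of the normalised weighted number `lastColSum b L E y / colConst b L` of completions of `E` through the
last face column (`LastFaceMonoStub.num_snoc`, `LastFaceMonoStub.cylZ_snoc`). -/
theorem cylProb_snoc {w L : ℕ} [NeZero L] (τ : Fin w → Bool) (b : Bool) (E : Set (CylCfg (w + 1) L)) :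
    cylProb (w + 1) L (Fin.snoc τ b) E =
      (∑ y : CylCfg w L, cylWeight w L τ y * (lastColSum b L E y / colConst b L)) / cylZ w L τ := by
  unfold cylProb
  rw [LastFaceMonoStub.num_snoc, LastFaceMonoStub.cylZ_snoc]
  simp_rw [← mul_div_assoc]
  rw [← Finset.sum_div, div_div, mul_comm (colConst b L)]

/-- **STUB · `stub_lastFaceMonoGen`**: `LastColMonoGen → LastFaceMonoGen`.  By `cylProb_snoc` the two sides of
`LastFaceMonoGen` are averages, with the same nonnegative weights `cylWeight w L τ` (`CylBunchStub.cylWeight_nonneg`)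
and the same partition function `cylZ w L τ` (`CylBunchStub.cylZ_nonneg`), of the two sides of the pointwise
inequality `LastColMonoGen`. -/
theorem stub_lastFaceMonoGen : LastColMonoGen → LastFaceMonoGen := by
  intro h w L _ hL τ E hE
  rw [cylProb_snoc, cylProb_snoc]
  exact div_le_div_of_nonneg_right
    (Finset.sum_le_sum fun y _ =>
      mul_le_mul_of_nonneg_left (h w L hL E hE y) (CylBunchStub.cylWeight_nonneg w L τ y))
    (CylBunchStub.cylZ_nonneg w L τ)

namespace OneWallStub

variable {m : ℕ}

/-- Precomposing the face types `τ` with the transposition `π` of the face columns `j₀` and `m` (the last one)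
gives `Fin.snoc θ (τ j₀)` for `θ j := τ (π j.castSucc)`. -/
theorem comp_swap (τ : Fin (m + 1) → Bool) (j₀ : Fin (m + 1)) :
    τ ∘ Equiv.swap j₀ (Fin.last m) =
      Fin.snoc (fun j : Fin m => τ (Equiv.swap j₀ (Fin.last m) j.castSucc)) (τ j₀) := by
  funext j
  induction j using Fin.lastCases with
  | last => rw [Fin.snoc_last, Function.comp_apply, Equiv.swap_apply_right]
  | cast i => rw [Fin.snoc_castSucc, Function.comp_apply]

/-- The transposition `π` of the face columns `j₀` and `m` never maps a non-last face column to `j₀` (the only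
preimage of `j₀` is the last face column). -/
theorem swap_castSucc_ne (j₀ : Fin (m + 1)) (i : Fin m) : Equiv.swap j₀ (Fin.last m) i.castSucc ≠ j₀ := by
  rw [Ne, Equiv.swap_apply_eq_iff, Equiv.swap_apply_left]
  exact Fin.castSucc_ne_last i

/-- Switching the face column `j₀` to honeycomb and precomposing with the transposition `π` of `j₀` and the last
face column gives `Fin.snoc θ false` with the SAME `θ j := τ (π j.castSucc)` as in `comp_swap`. -/
theorem update_comp_swap (τ : Fin (m + 1) → Bool) (j₀ : Fin (m + 1)) :
    Function.update τ j₀ false ∘ Equiv.swap j₀ (Fin.last m) =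
      Fin.snoc (fun j : Fin m => τ (Equiv.swap j₀ (Fin.last m) j.castSucc)) false := by
  funext j
  induction j using Fin.lastCases with
  | last => rw [Fin.snoc_last, Function.comp_apply, Equiv.swap_apply_right, Function.update_self]
  | cast i => rw [Fin.snoc_castSucc, Function.comp_apply, Function.update_of_ne (swap_castSucc_ne j₀ i)]

/-- THE STEP · switching ONE isotropic face column `j₀` to honeycomb does not increase the probability of a
wall-monotone event: `LastFaceMonoGen` on the last face column, moved into place by `PermInvariance` (the event
is determined off every interior column by `WallMonotoneOffCol`). -/
theorem cylProb_update_le (hP : PermInvariance) (hOff : WallMonotoneOffCol) (hM : LastFaceMonoGen) {L : ℕ}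
    [NeZero L] (hL : 3 ≤ L) (E : Set (CylCfg (m + 1) L)) (hE : WallMonotone E) (τ : Fin (m + 1) → Bool)
    (j₀ : Fin (m + 1)) (hj₀ : τ j₀ = true) :
    cylProb (m + 1) L (Function.update τ j₀ false) E ≤ cylProb (m + 1) L τ E := by
  have hO := hOff (m + 1) L E hE
  rw [← hP (m + 1) L hL E hO (Equiv.swap j₀ (Fin.last m)) (Function.update τ j₀ false),
    ← hP (m + 1) L hL E hO (Equiv.swap j₀ (Fin.last m)) τ, update_comp_swap, comp_swap, hj₀]
  exact hM m L hL _ E hE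

/-- Switching an isotropic face column `j₀` to honeycomb removes `j₀` from the set of isotropic face columns. -/
theorem filter_update (τ : Fin (m + 1) → Bool) (j₀ : Fin (m + 1)) :
    (univ.filter fun j => Function.update τ j₀ false j = true) =
      (univ.filter fun j => τ j = true).erase j₀ := by
  ext j
  simp only [Finset.mem_filter, Finset.mem_erase, Finset.mem_univ, true_and]
  by_cases h : j = j₀
  · subst h
    rw [Function.update_self]
    exact ⟨fun h' => absurd h' Bool.false_ne_true, fun h' => absurd rfl h'.1⟩
  · rw [Function.update_of_ne h]
    exact ⟨fun h' => ⟨h, h'⟩, fun h' => h'.2⟩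

/-- THE INDUCTION on the number `n` of isotropic face columns: the all-honeycomb probability of a wall-monotone
event is at most its probability for any face types (steps `cylProb_update_le`). -/
theorem cylProb_allHon_le (hP : PermInvariance) (hOff : WallMonotoneOffCol) (hM : LastFaceMonoGen) {L : ℕ}
    [NeZero L] (hL : 3 ≤ L) (E : Set (CylCfg (m + 1) L)) (hE : WallMonotone E) (n : ℕ) :
    ∀ τ : Fin (m + 1) → Bool, (univ.filter fun j => τ j = true).card = n →
      cylProb (m + 1) L (fun _ => false) E ≤ cylProb (m + 1) L τ E := by
  induction n with
  | zero =>
    intro τ hτ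
    have h : τ = fun _ => false := funext fun j => Bool.eq_false_iff.mpr fun hj =>
      Finset.filter_eq_empty_iff.mp (Finset.card_eq_zero.mp hτ) (Finset.mem_univ j) hj
    subst h
    exact le_rfl
  | succ n ih =>
    intro τ hτ
    obtain ⟨j₀, hj₀⟩ := Finset.card_pos.mp (by omega : 0 < (univ.filter fun j => τ j = true).card)
    refine (ih (Function.update τ j₀ false) ?_).trans
      (cylProb_update_le hP hOff hM hL E hE τ j₀ (Finset.mem_filter.mp hj₀).2)
    rw [filter_update, Finset.card_erase_of_mem hj₀, hτ, Nat.add_sub_cancel]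

end OneWallStub

/-- **STUB · `stub_oneWallDomination_of`**: `PermInvariance → WallMonotoneOffCol → LastFaceMonoGen →
OneWallDomination`.  Width `0`: the two face-type functions `Fin 0 → Bool` coincide.  Width `m + 1`:
`OneWallStub.cylProb_allHon_le` (induction on the number of isotropic face columns, each step one
`LastFaceMonoGen` transported to the switched column by `PermInvariance`). -/
theorem stub_oneWallDomination_of :
    PermInvariance → WallMonotoneOffCol → LastFaceMonoGen → OneWallDomination := by
  intro hP hOff hM w L _ hL τ E hE
  cases w with
  | zero => exact le_of_eq <| congrArg (fun τ => cylProb 0 L τ E) <| funext fun j => j.elim0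
  | succ m => exact OneWallStub.cylProb_allHon_le hP hOff hM hL E hE _ τ rfl

end Summit.CriticalPhenomena.CardyFormulaZ2.Theorems.IKLinearTransport.PinnedDiagramExchange.WallDomination

end
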